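import Literature.Analysis.FluidPDE.KelvinCirculationProofs
import HarnessLib

/-!
# Kelvin's circulation theorem with viscosity and force:
# `d/dt ∮_{C(t)} u · dℓ = ∮_{C(t)} (νΔu + f) · dℓ` — PROVED

Cell `pub/ns-blowup`, WANTED W12 (planner, KELVIN-LEG T1): the tree's Kelvin theorem
`IsClassicalEulerSolutionOn.circulation_eq_of_Icc` (`KelvinCirculationProofs.lean`; Majda–Bertozzi,
*Vorticity and Incompressible Flow*, CUP 2002, §1.6 Prop. 1.11) has force slot `0` and `ν = 0`.
This file proves the general transport identity for classical solutions of the forced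
Navier–Stokes system `∂ₜu + (u·∇)u = νΔu − ∇p + f` (`IsClassicalNSSolutionOn S ν f u p`, any
`ν : ℝ`, any force `f`): along a particle-trajectory map `X` (`∂ₜX = u(t, X)`) and a `C¹` loop `γ`,

* `IsClassicalNSSolutionOn.hasDerivAt_circulation_of_Icc` — at every interior time of a slab
  `[a, b]`, `d/dt ∮_{X(t,γ)} u(t)·dℓ = ∮_{X(t,γ)} (νΔu(t) + f(t))·dℓ`, i.e. Majda–Bertozzi's
  transport formula Prop. 1.10, eq. (1.58) `d/dt ∮_{C(t)} v·dℓ = ∮_{C(t)} Dv/Dt·dℓ` combined with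
  `Dv/Dt = −∇p + νΔv + f` and `∮_{C(t)} ∇p·dℓ = 0`; for `f = 0` this is their eq. (1.61),
  "`d/dt Γ_{C(t)} = ν ∮_{C(t)} Δv·dℓ`", and for `ν = 0`, `f = 0` it is Kelvin's theorem (1.60);
* `IsClassicalNSSolutionOn.circulation_sub_eq_integral` — the integrated form on `[a, b]`:
  `∮_{X(b,γ)} u(b)·dℓ − ∮_{X(a,γ)} u(a)·dℓ = ∫ₐᵇ ∮_{X(t,γ)} (νΔu + f)·dℓ dt`.

No hypothesis on `f` is needed beyond the momentum equation: on the slab `νΔu + f = ∂ₜu +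
(u·∇)u + ∇p` is jointly continuous because `u`, `p` are jointly smooth.

## Proof

Identical to the tree's proof of Prop. 1.11 (`KelvinCirculationProofs.lean`, whose lemmas
`kelvin_hasDerivAt_fderiv_flow` — `d/dt D(X t) w = D(u t)(D(X t) w)` — and
`kelvin_integral_deriv_integrand_eq_zero` — `∫₀¹ d/ds[½|u|² − p](X(t,γ s)) ds = 0` — are reused),
with the material derivative now `d/dt u(t, X(t,y)) = (νΔu − ∇p + f)(t, X(t,y))`
(`IsClassicalNSSolutionOn.hasDerivAt_velocity_comp_flow`): the time derivative of the integrand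
`⟪u(t,Y), ∂ₛY⟫` is `d/ds[½|u|² − p] + ⟪(νΔu + f)(t,Y), ∂ₛY⟫`, differentiation under the integral
sign (`kelvinForced_hasDerivAt_parametricIntegral`, dominated by a constant on a compact
time-neighbourhood) and the loop cancellation give the formula; the integrated form is the
fundamental theorem of calculus (`intervalIntegral.integral_eq_sub_of_hasDerivAt_of_le`).

## References

* A. J. Majda, A. L. Bertozzi, *Vorticity and Incompressible Flow*, CUP 2002
  (`MajdaBertozziCUP2002`): §1.6 Prop. 1.10 eq. (1.58), Prop. 1.11 eqs. (1.59)–(1.60), and the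
  viscous identity eq. (1.61), p. 23; §1.7 eq. (1.62).
-/

noncomputable section

open MeasureTheory Set Function Filter intervalIntegral
open _root_.Topology
open scoped ContDiff InnerProductSpace RealInnerProductSpace Laplacian

namespace Literature.Analysis.FluidPDE

/-! ### Parametric interval integrals: continuity and differentiation under the integral sign -/

section Parametric

/-- Continuity on `[a, b]` of `τ ↦ ∫₀¹ F(τ, s) ds` for `F` jointly continuous on `[a, b] × ℝ`
(`intervalIntegral.continuous_parametric_intervalIntegral_of_continuous'` on the subtype). [folklore] -/
private theorem kelvinForced_continuousOn_parametricIntegral {F : ℝ → ℝ → ℝ} {a b : ℝ}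
    (hF : ContinuousOn (uncurry F) (Icc a b ×ˢ univ)) :
    ContinuousOn (fun τ => ∫ s in (0 : ℝ)..1, F τ s) (Icc a b) := by
  rw [continuousOn_iff_continuous_restrict]
  have hc : Continuous (uncurry fun (τ : Icc a b) (s : ℝ) => F τ s) :=
    hF.comp_continuous ((continuous_subtype_val.comp continuous_fst).prodMk continuous_snd)
      fun z => ⟨z.1.2, mem_univ _⟩
  exact intervalIntegral.continuous_parametric_intervalIntegral_of_continuous' hc 0 1

/-- Differentiation under the integral sign at an interior time: for `F, F'` jointly continuous on
`[a, b] × ℝ` with `∂_τ F(τ, s) = F'(τ, s)` on `(a, b)`, `d/dτ ∫₀¹ F(τ, s) ds = ∫₀¹ F'(τ, s) ds` at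
every `τ ∈ (a, b)` (`intervalIntegral.hasDerivAt_integral_of_dominated_loc_of_deriv_le`, dominated
by a constant on a compact time-neighbourhood). [folklore] -/
private theorem kelvinForced_hasDerivAt_parametricIntegral {F F' : ℝ → ℝ → ℝ} {a b : ℝ}
    (hF : ContinuousOn (uncurry F) (Icc a b ×ˢ univ))
    (hF' : ContinuousOn (uncurry F') (Icc a b ×ˢ univ))
    (hderiv : ∀ t ∈ Ioo a b, ∀ s, HasDerivAt (fun τ => F τ s) (F' t s) t) {t : ℝ}
    (ht : t ∈ Ioo a b) :
    HasDerivAt (fun τ => ∫ s in (0 : ℝ)..1, F τ s) (∫ s in (0 : ℝ)..1, F' t s) t := by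
  have hsl : ∀ {G : ℝ → ℝ → ℝ}, ContinuousOn (uncurry G) (Icc a b ×ˢ univ) →
      ∀ t ∈ Icc a b, Continuous (G t) := by
    intro G hG t ht
    exact hG.comp_continuous (continuous_const.prodMk continuous_id) fun s => ⟨ht, mem_univ s⟩
  obtain ⟨ε, hε, hεsub⟩ :=
    Metric.nhds_basis_closedBall.mem_iff.1 (Ioo_mem_nhds ht.1 ht.2)
  have hK : IsCompact (Metric.closedBall t ε) := isCompact_closedBall t ε
  have hKS : Metric.closedBall t ε ⊆ Icc a b := hεsub.trans Ioo_subset_Icc_self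
  obtain ⟨C, hC⟩ := (hK.prod (isCompact_Icc (a := (0 : ℝ)) (b := 1))).exists_bound_of_continuousOn
    (hF'.mono (prod_mono hKS (subset_univ _)))
  have key := intervalIntegral.hasDerivAt_integral_of_dominated_loc_of_deriv_le
    (μ := volume) (a := (0 : ℝ)) (b := 1) (F := F) (F' := F') (x₀ := t) (bound := fun _ => C)
    (Metric.closedBall_mem_nhds t hε) ?_ ?_ ?_ ?_ ?_ ?_
  · exact key.2
  · filter_upwards [Icc_mem_nhds ht.1 ht.2] with x hx using (hsl hF x hx).aestronglyMeasurable
  · exact (hsl hF t (Ioo_subset_Icc_self ht)).intervalIntegrable 0 1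
  · exact (hsl hF' t (Ioo_subset_Icc_self ht)).aestronglyMeasurable
  · refine ae_of_all _ fun s hs x hx => hC (x, s) ⟨hx, ?_⟩
    rw [uIoc_of_le (zero_le_one : (0 : ℝ) ≤ 1)] at hs
    exact Ioc_subset_Icc_self hs
  · exact intervalIntegrable_const
  · exact ae_of_all _ fun s _ x hx => hderiv x (hεsub hx) s

end Parametric

/-! ### The material derivative with viscosity and force -/

section Kelvin

variable {E : Type*} [NormedAddCommGroup E] [InnerProductSpace ℝ E] [FiniteDimensional ℝ E]
variable {S : Set ℝ} {ν : ℝ} {f u : ℝ → E → E} {p : ℝ → E → ℝ} {X : ℝ → E → E}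

/-- **The Navier–Stokes equation in joint-derivative form at an interior time.** For a classical
solution of `∂ₜu + (u·∇)u = νΔu − ∇p + f` on `S` and `t` in the interior of `S`,
`D(uncurry u)(t, z)(1, u(t, z)) = ∂ₜu + (u·∇)u = νΔu − ∇p + f` at `(t, z)` (Majda–Bertozzi,
eq. (1.62) with the viscous and forcing terms of (1.1)). [cite: MajdaBertozziCUP2002, §1.7 eq. (1.62) and §1.1 eq. (1.1)] -/
theorem IsClassicalNSSolutionOn.fderiv_uncurry_apply_one_velocity
    (h : IsClassicalNSSolutionOn S ν f u p) {t : ℝ} (ht : S ∈ 𝓝 t) (z : E) :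
    fderiv ℝ (uncurry u) (t, z) (1, u t z) = ν • Δ (u t) z - gradient (p t) z + f t z := by
  have htS : t ∈ interior S := mem_interior_iff_mem_nhds.2 ht
  have hu : IsSmoothSpaceTimeOn (interior S) u := h.smooth_velocity.mono interior_subset
  have hm := h.momentum t (interior_subset htS) z
  rw [timeDerivWithin_eq_deriv_of_mem_nhds ht, hu.deriv_timeLine isOpen_interior htS z,
    convect_apply, hu.fderiv_slice_apply_of_isOpen isOpen_interior htS z (u t z), ← map_add] at hm
  simpa using hm

/-- **Material derivative of the velocity along a particle trajectory, with viscosity and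
force.** If `∂ₜX(t, a) = u(t, X(t, a))` within `S`, then at an interior time `t` of `S`,
`d/dt u(t, X(t, y)) = (∂ₜu + (u·∇)u)(t, X(t, y)) = (νΔu − ∇p + f)(t, X(t, y))`
(Majda–Bertozzi, eqs. (1.13), (1.62), with the right-hand side of (1.1)). [cite: MajdaBertozziCUP2002, §1.6–1.7, eqs. (1.13), (1.62)] -/
theorem IsClassicalNSSolutionOn.hasDerivAt_velocity_comp_flow
    (h : IsClassicalNSSolutionOn S ν f u p)
    (hXu : ∀ t ∈ S, ∀ a, HasDerivWithinAt (fun s => X s a) (u t (X t a)) S t)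
    {t : ℝ} (ht : S ∈ 𝓝 t) (y : E) :
    HasDerivAt (fun τ => u τ (X τ y))
      (ν • Δ (u t) (X t y) - gradient (p t) (X t y) + f t (X t y)) t := by
  have htS : t ∈ interior S := mem_interior_iff_mem_nhds.2 ht
  have hu : IsSmoothSpaceTimeOn (interior S) u := h.smooth_velocity.mono interior_subset
  have hc : HasDerivAt (fun τ : ℝ => (τ, X τ y)) ((1 : ℝ), u t (X t y)) t :=
    (hasDerivAt_id' t).prodMk ((hXu t (interior_subset htS) y).hasDerivAt ht)
  have hU : HasFDerivAt (uncurry u) (fderiv ℝ (uncurry u) (t, X t y)) (t, X t y) :=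
    ((hu.contDiffAt isOpen_interior htS (X t y)).differentiableAt (by simp)).hasFDerivAt
  have h2 := hU.comp_hasDerivAt t hc
  rw [h.fderiv_uncurry_apply_one_velocity ht] at h2
  exact h2

/-- **Time derivative of the circulation integrand, with viscosity and force** (the computation
behind Majda–Bertozzi (1.58) and (1.61)): at an interior time `t` of `S`, for fixed `y, w`,
`d/dt ⟪u(t, X(t,y)), D(X t)(y) w⟫ = (⟪u(t,Y), D(u t)(Y) B⟫ − D(p t)(Y) B) + ⟪νΔu(t,Y) + f(t,Y), B⟫`,
`Y = X(t,y)`, `B = D(X t)(y) w`. [cite: MajdaBertozziCUP2002, §1.6 Prop. 1.10 eq. (1.58) and eq. (1.61)] -/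
theorem IsClassicalNSSolutionOn.hasDerivAt_circulation_integrand
    (h : IsClassicalNSSolutionOn S ν f u p) (hX : IsSmoothSpaceTimeOn S X)
    (hXu : ∀ t ∈ S, ∀ a, HasDerivWithinAt (fun s => X s a) (u t (X t a)) S t)
    {t : ℝ} (ht : S ∈ 𝓝 t) (y w : E) :
    HasDerivAt (fun τ => ⟪u τ (X τ y), fderiv ℝ (X τ) y w⟫)
      ((⟪u t (X t y), fderiv ℝ (u t) (X t y) (fderiv ℝ (X t) y w)⟫
        - fderiv ℝ (p t) (X t y) (fderiv ℝ (X t) y w))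
        + ⟪ν • Δ (u t) (X t y) + f t (X t y), fderiv ℝ (X t) y w⟫) t := by
  have hG := h.hasDerivAt_velocity_comp_flow hXu ht y
  have hB := kelvin_hasDerivAt_fderiv_flow h.smooth_velocity hX hXu ht y w
  refine (hG.inner ℝ hB).congr_deriv ?_
  rw [show ν • Δ (u t) (X t y) - gradient (p t) (X t y) + f t (X t y) =
      (ν • Δ (u t) (X t y) + f t (X t y)) - gradient (p t) (X t y) by abel,
    inner_sub_left, inner_gradient_left]
  ring

/-- On the slab, `νΔu + f = ∂ₜu + (u·∇)u + ∇p` is jointly continuous (no regularity of `f` is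
assumed beyond the momentum equation). [cite: MajdaBertozziCUP2002, §1.1 eq. (1.1)] -/
theorem IsClassicalNSSolutionOn.continuousOn_laplacian_add_force {a b : ℝ} (hab : a < b)
    (h : IsClassicalNSSolutionOn (Icc a b) ν f u p) :
    ContinuousOn (fun z : ℝ × E => ν • Δ (u z.1) z.2 + f z.1 z.2) (Icc a b ×ˢ univ) := by
  have hSU : UniqueDiffOn ℝ (Icc a b) := uniqueDiffOn_Icc hab
  have h1 := h.smooth_velocity.continuousOn_timeDerivWithin hSU
  have h2 : ContinuousOn (fun z : ℝ × E => convect (u z.1) (u z.1) z.2) (Icc a b ×ˢ univ) :=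
    (h.smooth_velocity.continuousOn_fderiv_slice hSU).clm_apply h.smooth_velocity.continuousOn
  have h3 : ContinuousOn (fun z : ℝ × E => gradient (p z.1) z.2) (Icc a b ×ˢ univ) :=
    (InnerProductSpace.toDual ℝ E).symm.continuous.comp_continuousOn
      (h.smooth_pressure.continuousOn_fderiv_slice hSU)
  refine ((h1.add h2).add h3).congr fun z hz => ?_
  have hm := h.momentum z.1 hz.1 z.2
  show ν • Δ (u z.1) z.2 + f z.1 z.2 =
    timeDerivWithin (Icc a b) u z.1 z.2 + convect (u z.1) (u z.1) z.2 + gradient (p z.1) z.2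
  rw [hm]
  abel

/-- **Kelvin's circulation theorem with viscosity and force, differential form on a compact
slab** `S = [a, b]`: for a classical solution of `∂ₜu + (u·∇)u = νΔu − ∇p + f` on `[a, b] × E`, a
jointly smooth particle-trajectory map `X` with `∂ₜX = u(t, X)` within `[a, b]`, and a `C¹` loop
`γ`, at every interior time
`d/dt ∮_{X(t,γ)} u(t)·dℓ = ∮_{X(t,γ)} (νΔu(t) + f(t))·dℓ` (Majda–Bertozzi, Prop. 1.10 eq. (1.58)
with `Dv/Dt = −∇p + νΔv + f`; for `f = 0` this is eq. (1.61), for `ν = 0 = f` eq. (1.60)).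
[cite: MajdaBertozziCUP2002, §1.6 Prop. 1.10 eq. (1.58) and eq. (1.61)] -/
theorem IsClassicalNSSolutionOn.hasDerivAt_circulation_of_Icc {a b : ℝ} (hab : a < b)
    (h : IsClassicalNSSolutionOn (Icc a b) ν f u p) (hX : IsSmoothSpaceTimeOn (Icc a b) X)
    (hXu : ∀ t ∈ Icc a b, ∀ y, HasDerivWithinAt (fun s => X s y) (u t (X t y)) (Icc a b) t)
    {γ : ℝ → E} (hγ : ContDiff ℝ 1 γ) (hloop : γ 0 = γ 1) {t : ℝ} (ht : t ∈ Ioo a b) :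
    HasDerivAt (fun τ => circulation (u τ) (X τ ∘ γ))
      (circulation (fun x => ν • Δ (u t) x + f t x) (X t ∘ γ)) t := by
  have hSU : UniqueDiffOn ℝ (Icc a b) := uniqueDiffOn_Icc hab
  have hγc : Continuous γ := hγ.continuous
  have hγ'c : Continuous (deriv γ) := hγ.continuous_deriv le_rfl
  have htI : t ∈ Icc a b := Ioo_subset_Icc_self ht
  -- circulations in slice form
  have hcirc : ∀ τ ∈ Icc a b, ∀ v : E → E, circulation v (X τ ∘ γ) =
      ∫ s in (0 : ℝ)..1, ⟪v (X τ (γ s)), fderiv ℝ (X τ) (γ s) (deriv γ s)⟫ := by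
    intro τ hτ v
    unfold circulation
    refine intervalIntegral.integral_congr fun s _ => ?_
    simp only [Function.comp_apply]
    rw [fderiv_comp_deriv s ((hX.contDiff_slice hτ).differentiable (by simp) _)
      (hγ.differentiable one_ne_zero s)]
  -- joint continuity of the building blocks on `[a, b] × ℝ`
  have hmaps : MapsTo (fun z : ℝ × ℝ => (z.1, γ z.2)) (Icc a b ×ˢ univ) (Icc a b ×ˢ univ) :=
    fun z hz => ⟨hz.1, mem_univ _⟩
  have hY : ContinuousOn (fun z : ℝ × ℝ => X z.1 (γ z.2)) (Icc a b ×ˢ univ) :=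
    hX.continuousOn.comp (continuousOn_fst.prodMk (hγc.comp continuous_snd).continuousOn) hmaps
  have hmapsY : MapsTo (fun z : ℝ × ℝ => (z.1, X z.1 (γ z.2))) (Icc a b ×ˢ univ)
      (Icc a b ×ˢ univ) := fun z hz => ⟨hz.1, mem_univ _⟩
  have hB : ContinuousOn (fun z : ℝ × ℝ => fderiv ℝ (X z.1) (γ z.2) (deriv γ z.2))
      (Icc a b ×ˢ univ) := by
    have h1 : ContinuousOn (fun z : ℝ × ℝ => fderiv ℝ (X z.1) (γ z.2)) (Icc a b ×ˢ univ) :=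
      (hX.fderiv_slice hSU).continuousOn.comp
        (continuousOn_fst.prodMk (hγc.comp continuous_snd).continuousOn) hmaps
    exact h1.clm_apply (hγ'c.comp continuous_snd).continuousOn
  have hUY : ContinuousOn (fun z : ℝ × ℝ => u z.1 (X z.1 (γ z.2))) (Icc a b ×ˢ univ) :=
    h.smooth_velocity.continuousOn.comp (continuousOn_fst.prodMk hY) hmapsY
  -- `νΔu + f = ∂ₜu + (u·∇)u + ∇p` along `Y` (pieces composed separately, then the momentum eq.)
  have hGY : ContinuousOn (fun z : ℝ × ℝ => ν • Δ (u z.1) (X z.1 (γ z.2)) + f z.1 (X z.1 (γ z.2)))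
      (Icc a b ×ˢ univ) := by
    have g1 : ContinuousOn (fun z : ℝ × ℝ => timeDerivWithin (Icc a b) u z.1 (X z.1 (γ z.2)))
        (Icc a b ×ˢ univ) :=
      (h.smooth_velocity.continuousOn_timeDerivWithin hSU).comp (continuousOn_fst.prodMk hY) hmapsY
    have g2 : ContinuousOn (fun z : ℝ × ℝ => convect (u z.1) (u z.1) (X z.1 (γ z.2)))
        (Icc a b ×ˢ univ) :=
      ((h.smooth_velocity.fderiv_slice hSU).continuousOn.comp (continuousOn_fst.prodMk hY)
        hmapsY).clm_apply hUY
    have g3 : ContinuousOn (fun z : ℝ × ℝ => gradient (p z.1) (X z.1 (γ z.2))) (Icc a b ×ˢ univ) :=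
      (InnerProductSpace.toDual ℝ E).symm.continuous.comp_continuousOn
        ((h.smooth_pressure.fderiv_slice hSU).continuousOn.comp (continuousOn_fst.prodMk hY) hmapsY)
    refine ((g1.add g2).add g3).congr fun z hz => ?_
    have hm := h.momentum z.1 hz.1 (X z.1 (γ z.2))
    show ν • Δ (u z.1) (X z.1 (γ z.2)) + f z.1 (X z.1 (γ z.2)) =
      timeDerivWithin (Icc a b) u z.1 (X z.1 (γ z.2)) + convect (u z.1) (u z.1) (X z.1 (γ z.2)) +
        gradient (p z.1) (X z.1 (γ z.2))
    rw [hm]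
    abel
  have hDU : ContinuousOn (fun z : ℝ × ℝ =>
      fderiv ℝ (u z.1) (X z.1 (γ z.2)) (fderiv ℝ (X z.1) (γ z.2) (deriv γ z.2)))
      (Icc a b ×ˢ univ) := by
    have h1 : ContinuousOn (fun z : ℝ × ℝ => fderiv ℝ (u z.1) (X z.1 (γ z.2))) (Icc a b ×ˢ univ) :=
      (h.smooth_velocity.fderiv_slice hSU).continuousOn.comp (continuousOn_fst.prodMk hY) hmapsY
    exact h1.clm_apply hB
  have hDP : ContinuousOn (fun z : ℝ × ℝ =>
      fderiv ℝ (p z.1) (X z.1 (γ z.2)) (fderiv ℝ (X z.1) (γ z.2) (deriv γ z.2)))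
      (Icc a b ×ˢ univ) := by
    have h1 : ContinuousOn (fun z : ℝ × ℝ => fderiv ℝ (p z.1) (X z.1 (γ z.2))) (Icc a b ×ˢ univ) :=
      (h.smooth_pressure.fderiv_slice hSU).continuousOn.comp (continuousOn_fst.prodMk hY) hmapsY
    exact h1.clm_apply hB
  -- differentiation under the integral sign
  have hd := kelvinForced_hasDerivAt_parametricIntegral
    (F := fun τ s => ⟪u τ (X τ (γ s)), fderiv ℝ (X τ) (γ s) (deriv γ s)⟫)
    (F' := fun τ s =>
      (⟪u τ (X τ (γ s)), fderiv ℝ (u τ) (X τ (γ s)) (fderiv ℝ (X τ) (γ s) (deriv γ s))⟫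
        - fderiv ℝ (p τ) (X τ (γ s)) (fderiv ℝ (X τ) (γ s) (deriv γ s)))
        + ⟪ν • Δ (u τ) (X τ (γ s)) + f τ (X τ (γ s)), fderiv ℝ (X τ) (γ s) (deriv γ s)⟫)
    (hUY.inner hB) (((hUY.inner hDU).sub hDP).add (hGY.inner hB))
    (fun τ hτ s => h.hasDerivAt_circulation_integrand hX hXu (Icc_mem_nhds hτ.1 hτ.2) (γ s)
      (deriv γ s)) ht
  -- the loop part integrates to zero, the rest is the circulation of `νΔu + f`
  have hsl : ∀ {G : ℝ × ℝ → ℝ}, ContinuousOn G (Icc a b ×ˢ univ) →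
      Continuous (fun s => G (t, s)) := by
    intro G hG
    exact hG.comp_continuous (continuous_const.prodMk continuous_id) fun s => ⟨htI, mem_univ s⟩
  have hi1 : IntervalIntegrable (fun s =>
      ⟪u t (X t (γ s)), fderiv ℝ (u t) (X t (γ s)) (fderiv ℝ (X t) (γ s) (deriv γ s))⟫
        - fderiv ℝ (p t) (X t (γ s)) (fderiv ℝ (X t) (γ s) (deriv γ s))) volume 0 1 :=
    (hsl ((hUY.inner hDU).sub hDP)).intervalIntegrable 0 1
  have hi2 : IntervalIntegrable (fun s =>
      ⟪ν • Δ (u t) (X t (γ s)) + f t (X t (γ s)), fderiv ℝ (X t) (γ s) (deriv γ s)⟫) volume 0 1 :=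
    (hsl (hGY.inner hB)).intervalIntegrable 0 1
  have hval : (∫ s in (0 : ℝ)..1,
      ((⟪u t (X t (γ s)), fderiv ℝ (u t) (X t (γ s)) (fderiv ℝ (X t) (γ s) (deriv γ s))⟫
        - fderiv ℝ (p t) (X t (γ s)) (fderiv ℝ (X t) (γ s) (deriv γ s)))
        + ⟪ν • Δ (u t) (X t (γ s)) + f t (X t (γ s)), fderiv ℝ (X t) (γ s) (deriv γ s)⟫)) =
      circulation (fun x => ν • Δ (u t) x + f t x) (X t ∘ γ) := by
    rw [intervalIntegral.integral_add hi1 hi2,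
      kelvin_integral_deriv_integrand_eq_zero h.smooth_velocity h.smooth_pressure hX hγ hloop htI hi1,
      zero_add, hcirc t htI]
  -- back to `circulation (u τ) (X τ ∘ γ)` near `t`
  refine (hd.congr_deriv hval).congr_of_eventuallyEq ?_
  filter_upwards [Icc_mem_nhds ht.1 ht.2] with τ hτ
  exact hcirc τ hτ (u τ)

/-- **Kelvin's circulation theorem with viscosity and force, integrated form**: on a compact slab
`[a, b]`, `∮_{X(b,γ)} u(b)·dℓ − ∮_{X(a,γ)} u(a)·dℓ = ∫ₐᵇ ∮_{X(t,γ)} (νΔu(t) + f(t))·dℓ dt`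
(Majda–Bertozzi, eq. (1.61) with force, integrated in time; the circulation is continuous on
`[a, b]` and differentiable inside with the derivative of
`IsClassicalNSSolutionOn.hasDerivAt_circulation_of_Icc`). [cite: MajdaBertozziCUP2002, §1.6 eq. (1.61)] -/
theorem IsClassicalNSSolutionOn.circulation_sub_eq_integral {a b : ℝ} (hab : a < b)
    (h : IsClassicalNSSolutionOn (Icc a b) ν f u p) (hX : IsSmoothSpaceTimeOn (Icc a b) X)
    (hXu : ∀ t ∈ Icc a b, ∀ y, HasDerivWithinAt (fun s => X s y) (u t (X t y)) (Icc a b) t)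
    {γ : ℝ → E} (hγ : ContDiff ℝ 1 γ) (hloop : γ 0 = γ 1) :
    circulation (u b) (X b ∘ γ) - circulation (u a) (X a ∘ γ) =
      ∫ t in a..b, circulation (fun x => ν • Δ (u t) x + f t x) (X t ∘ γ) := by
  have hSU : UniqueDiffOn ℝ (Icc a b) := uniqueDiffOn_Icc hab
  have hγc : Continuous γ := hγ.continuous
  have hγ'c : Continuous (deriv γ) := hγ.continuous_deriv le_rfl
  have hcirc : ∀ τ ∈ Icc a b, ∀ v : E → E, circulation v (X τ ∘ γ) =
      ∫ s in (0 : ℝ)..1, ⟪v (X τ (γ s)), fderiv ℝ (X τ) (γ s) (deriv γ s)⟫ := by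
    intro τ hτ v
    unfold circulation
    refine intervalIntegral.integral_congr fun s _ => ?_
    simp only [Function.comp_apply]
    rw [fderiv_comp_deriv s ((hX.contDiff_slice hτ).differentiable (by simp) _)
      (hγ.differentiable one_ne_zero s)]
  have hmaps : MapsTo (fun z : ℝ × ℝ => (z.1, γ z.2)) (Icc a b ×ˢ univ) (Icc a b ×ˢ univ) :=
    fun z hz => ⟨hz.1, mem_univ _⟩
  have hY : ContinuousOn (fun z : ℝ × ℝ => X z.1 (γ z.2)) (Icc a b ×ˢ univ) :=
    hX.continuousOn.comp (continuousOn_fst.prodMk (hγc.comp continuous_snd).continuousOn) hmaps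
  have hmapsY : MapsTo (fun z : ℝ × ℝ => (z.1, X z.1 (γ z.2))) (Icc a b ×ˢ univ)
      (Icc a b ×ˢ univ) := fun z hz => ⟨hz.1, mem_univ _⟩
  have hB : ContinuousOn (fun z : ℝ × ℝ => fderiv ℝ (X z.1) (γ z.2) (deriv γ z.2))
      (Icc a b ×ˢ univ) := by
    have h1 : ContinuousOn (fun z : ℝ × ℝ => fderiv ℝ (X z.1) (γ z.2)) (Icc a b ×ˢ univ) :=
      (hX.fderiv_slice hSU).continuousOn.comp
        (continuousOn_fst.prodMk (hγc.comp continuous_snd).continuousOn) hmaps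
    exact h1.clm_apply (hγ'c.comp continuous_snd).continuousOn
  have hUY : ContinuousOn (fun z : ℝ × ℝ => u z.1 (X z.1 (γ z.2))) (Icc a b ×ˢ univ) :=
    h.smooth_velocity.continuousOn.comp (continuousOn_fst.prodMk hY) hmapsY
  -- `νΔu + f = ∂ₜu + (u·∇)u + ∇p` along `Y` (pieces composed separately, then the momentum eq.)
  have hGY : ContinuousOn (fun z : ℝ × ℝ => ν • Δ (u z.1) (X z.1 (γ z.2)) + f z.1 (X z.1 (γ z.2)))
      (Icc a b ×ˢ univ) := by
    have g1 : ContinuousOn (fun z : ℝ × ℝ => timeDerivWithin (Icc a b) u z.1 (X z.1 (γ z.2)))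
        (Icc a b ×ˢ univ) :=
      (h.smooth_velocity.continuousOn_timeDerivWithin hSU).comp (continuousOn_fst.prodMk hY) hmapsY
    have g2 : ContinuousOn (fun z : ℝ × ℝ => convect (u z.1) (u z.1) (X z.1 (γ z.2)))
        (Icc a b ×ˢ univ) :=
      ((h.smooth_velocity.fderiv_slice hSU).continuousOn.comp (continuousOn_fst.prodMk hY)
        hmapsY).clm_apply hUY
    have g3 : ContinuousOn (fun z : ℝ × ℝ => gradient (p z.1) (X z.1 (γ z.2))) (Icc a b ×ˢ univ) :=
      (InnerProductSpace.toDual ℝ E).symm.continuous.comp_continuousOn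
        ((h.smooth_pressure.fderiv_slice hSU).continuousOn.comp (continuousOn_fst.prodMk hY) hmapsY)
    refine ((g1.add g2).add g3).congr fun z hz => ?_
    have hm := h.momentum z.1 hz.1 (X z.1 (γ z.2))
    show ν • Δ (u z.1) (X z.1 (γ z.2)) + f z.1 (X z.1 (γ z.2)) =
      timeDerivWithin (Icc a b) u z.1 (X z.1 (γ z.2)) + convect (u z.1) (u z.1) (X z.1 (γ z.2)) +
        gradient (p z.1) (X z.1 (γ z.2))
    rw [hm]
    abel
  -- continuity of the circulation and of its derivative on `[a, b]`
  have hcontΓ : ContinuousOn (fun τ => circulation (u τ) (X τ ∘ γ)) (Icc a b) :=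
    (kelvinForced_continuousOn_parametricIntegral
      (F := fun τ s => ⟪u τ (X τ (γ s)), fderiv ℝ (X τ) (γ s) (deriv γ s)⟫) (hUY.inner hB)).congr
      fun τ hτ => hcirc τ hτ (u τ)
  have hcontD : ContinuousOn (fun τ => circulation (fun x => ν • Δ (u τ) x + f τ x) (X τ ∘ γ))
      (Icc a b) :=
    (kelvinForced_continuousOn_parametricIntegral
      (F := fun τ s => ⟪ν • Δ (u τ) (X τ (γ s)) + f τ (X τ (γ s)), fderiv ℝ (X τ) (γ s) (deriv γ s)⟫)
      (hGY.inner hB)).congr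
      fun τ hτ => hcirc τ hτ _
  have hsubI : uIcc a b ⊆ Icc a b := by rw [uIcc_of_le hab.le]
  have hint : IntervalIntegrable
      (fun τ => circulation (fun x => ν • Δ (u τ) x + f τ x) (X τ ∘ γ)) volume a b :=
    (hcontD.mono hsubI).intervalIntegrable
  exact (intervalIntegral.integral_eq_sub_of_hasDerivAt_of_le hab.le hcontΓ
    (fun t ht => h.hasDerivAt_circulation_of_Icc hab hX hXu hγ hloop ht) hint).symm

end Kelvin

end Literature.Analysis.FluidPDE

end
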